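import Literature.Computability.MetaComplexity.ClockedUniversalRun
import Literature.Computability.Complexity.SharpSATMembership
import HarnessLib

/-!
# Buss's `SAT(x, y)`: "the CNF coded by `x` is satisfied by the bits of `y`", `Δᵇ₁` in `S₂¹`

Topic `Literature/Computability/MetaComplexity`; definition request `defn-BussSatFormula` (route
`PneNP/FeasibleWitnessing`, item `ProvableWitnessing`): the predicate `SAT_n(x, y)` of
Pich–Santhanam [PichSanthanam2026, §1.2 and §3.2] — "`y` is a satisfying assignment of the
`n`-bit CNF `x`", formalised in `PV` / `S₂¹` by a polynomial-time algorithm — is needed to write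
the witnessing sentences `W^{k,u}_{n₀}(f)` (ibid., Cor. 20) in Buss's language.

## What is defined

* **The meaning in `ℕ`** (`BussSat x y`): the string `numStr x` (the binary digits of `x` below its
  leading `1`; `ClockedUniversalRun.lean`, the coding shared by the route's three definitions) is
  read as the G01 code of a CNF over `ℕ` by the tree's encoding `encodingCNF`
  (`Literature/Computability/Complexity/CNF.lean`) through its TOTAL decoder `NegCNF.decCNF`
  (`encodingCNF.decode w = some (decCNF w)` for every `w`, `NegCNF.decode_cnf`), and evaluated
  under the assignment `i ↦ bit i of y` (`Nat.testBit`); `bussSat_iff_decode` is the requested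
  reading `∃ φ, encodingCNF.decode (numStr x) = some φ ∧ φ.eval (bit · y) = true`.
* **Its characteristic function is polynomial time** (`polyTime_satChar`): an assembly of the
  tree's `FP` bricks — canonicalise the code (`KSATRed.canonCNFFn = encode ∘ decCNF`), then
  `allFn` over the clause codes of `anyFn` over the literal codes of the one-bit test
  "bit `v` of `y` equals the polarity" (`Brick.allFn`/`anyFn` of `ListFoldBricks.lean`,
  `bitAtFn`/`binToUnaryFn` of `FPStringBricks.lean`), on the two halves of the pairing
  `pairVal x y` (`ClockedRun.lowF`/`highF`).
* **The uniform `Σᵇ₁` definition** `satG : GDef 2` of that characteristic function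
  (`GDef.ofPolyTime`, i.e. the tree's `S2Machine.machineG` — Buss 1986, Ch. 3: every
  polynomial-time function is `Σᵇ₁`-definable in `S₂¹` — at the pairing term `pairTm x₀ x₁`), good
  in every model of `S₂¹` (`good_satG`) with value `[BussSat x y]` in `ℕ` (`fn_satG`).
* For ANY definition `G : GDef n` the two forms of "`G(x̄) = 1`" (Buss 1986, §2.2, Thm. 2.2: atomic
  formulas in `Σᵇ₁`-defined functions are `Δᵇ₁`): `GDef.isOneSig G = ∃ y ≤ t(x̄) (φ_G(x̄, y) ∧ y = 1)`
  (syntactically `Σᵇ₁`, `GDef.isSig_isOneSig`) and `GDef.isOnePi G = ∀ y ≤ t(x̄) (φ_G(x̄, y) → y = 1)`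
  (syntactically `Πᵇ₁`, `GDef.isPi_isOnePi`), equivalent — to `G.fn x̄ = 1` — in every structure in
  which `G` is total and functional (`GDef.realize_isOneSig`, `GDef.realize_isOnePi`), hence
  `S₂¹ ⊨ᵇ isOneSig G ⇔ isOnePi G` for good `G` (`GDef.models_isOneSig_iff_isOnePi`).
* **`bussSatFormula : Language.boundedArith.Formula (Fin 2)`** — THE requested formula
  `SAT(x₀, x₁)`, the `Σᵇ₁` form `(isOneSig satG).toFormula` (`isSigmab_bussSatFormula`); its `Πᵇ₁`
  form `bussSatFormulaPi` (`isPib_bussSatFormulaPi`); **`Δᵇ₁` with respect to `S₂¹`**: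
  `bussSatFormula_iff_pi : S2 1 ⊨ᵇ bussSatFormula ⇔ bussSatFormulaPi`; and the **agreement in the
  standard model** `realize_bussSatFormula : bussSatFormula.Realize ![x, y] ↔ BussSat x y`
  (`realize_bussSatFormula_iff_decode` in the decoder form).

## Conventions

Strings are named by numbers through `numStr`/`strNum` (the "`1x`" bijection `ℕ_{≥1} ≃ {0,1}*`,
`ClockedUniversalRun.lean`), so "`x` is an `n`-bit CNF code" reads `|x| = n + 1`; the assignment
reads the binary digits of `y` directly (`bit i of y`, as printed), so an assignment to the
variables `< n` is any `y < 2ⁿ` (or any `y`, higher bits being irrelevant to variables `< n`).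

## References

* S. R. Buss, *Bounded Arithmetic*, Bibliopolis 1986, §2.2 (Thm. 2.2: `Δᵇ₁` atomic formulas of
  `Σᵇ₁`-defined functions), Ch. 3 (polynomial-time functions are `Σᵇ₁`-definable in `S₂¹`).
* J. Krajíček, *Bounded Arithmetic, Propositional Logic and Complexity Theory*, CUP 1995, §5.2,
  §6.1 (Lemma 6.1.1).
* J. Pich, R. Santhanam, *Towards P ≠ NP from Extended Frege lower bounds*, J. ACM 73 (2026),
  §1.2, §3.2 (`SAT_n(x, y)`), Cor. 20.
* S. Arora, B. Barak, *Computational Complexity*, CUP 2009, Def. 2.9 (CNF semantics), §1.3.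
-/

noncomputable section

namespace Literature.Computability.MetaComplexity

open FirstOrder FirstOrder.Language
open _root_.Computability
open Literature.Computability.Complexity Literature.Computability.Complexity.Brick
open Literature.Computability.Complexity.SharpSATVerif (encode_literal sndF_encode_clause
  sndF_encode_cnf)

/-! ## The predicate in the standard model -/

/-- **The CNF named by the number `x`**: the G01 code `numStr x` read by the total decoder of
`encodingCNF` (`NegCNF.decCNF`; `decode_numStr`). [cite: AroraBarak2009, Def. 2.9 and §0.1] -/
def cnfOfNum (x : ℕ) : CNF ℕ :=
  NegCNF.decCNF (numStr x)

/-- `encodingCNF` decodes `numStr x` to `cnfOfNum x` (the decoder is total). [folklore] -/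
theorem decode_numStr (x : ℕ) : encodingCNF.decode (numStr x) = some (cnfOfNum x) :=
  NegCNF.decode_cnf _

/-- **The assignment named by the number `y`**: variable `i ↦` bit `i` of `y`.
[cite: Krajicek1995, §5.2] -/
def bitAssign (y : ℕ) : ℕ → Bool :=
  fun i => y.testBit i

/-- **Buss's `SAT(x, y)` in `ℕ`**: the CNF coded by `x` is satisfied by the assignment whose
`i`-th value is bit `i` of `y` (Pich–Santhanam's `SAT_n(x, y)`, read through the tree's codes).
[cite: PichSanthanam2026, §3.2] -/
def BussSat (x y : ℕ) : Prop :=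
  (cnfOfNum x).eval (bitAssign y) = true

/-- `BussSat` is decidable. [folklore] -/
instance (x y : ℕ) : Decidable (BussSat x y) := by
  unfold BussSat; infer_instance

/-- **The decoder reading** (as requested): `SAT(x, y)` iff `numStr x` decodes to a CNF made true by
the bits of `y`. [cite: PichSanthanam2026, §3.2] -/
theorem bussSat_iff_decode (x y : ℕ) :
    BussSat x y ↔ ∃ φ : CNF ℕ, encodingCNF.decode (numStr x) = some φ ∧ φ.eval (fun i => y.testBit i) = true := by
  rw [decode_numStr]
  constructor
  · intro h; exact ⟨_, rfl, h⟩
  · rintro ⟨φ, hφ, h⟩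
    rw [Option.some.injEq] at hφ
    rw [BussSat, hφ]; exact h

/-- On genuine codes: `SAT(strNum (code φ), y) ↔ φ` is true under the bits of `y`. [folklore] -/
theorem bussSat_strNum_encode (φ : CNF ℕ) (y : ℕ) :
    BussSat (strNum (encodingCNF.encode φ)) y ↔ φ.eval (bitAssign y) = true := by
  have h := NegCNF.decode_cnf (encodingCNF.encode φ)
  rw [encodingCNF.decode_encode, Option.some.injEq] at h
  rw [BussSat, cnfOfNum, numStr_strNum, ← h]

/-! ## The characteristic function is polynomial time (bricks) -/

namespace BussSatFn

/-- **The bit of the context at the position named by the item's first field**, on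
`⟨u, ⟨v̂, p⟩⟩` (`u` a bit string, `v̂` a numeral): `[u[⟦v̂⟧]]`, and `[0]` beyond the end of `u`
(`bitOfF_boolPair`). [folklore] -/
def bitOfF : List Bool → List Bool :=
  ClockedRun.take1F ∘ fun z =>
    (bitAtFn ∘ fanoutFn (binToUnaryFn ∘ fanoutFn fstF (fstF ∘ sndF)) fstF) z ++ [false]

/-- `bitOfF ∈ FP`. [folklore] -/
theorem bitOfF_mem_FP : bitOfF ∈ FP :=
  comp_mem_FP ClockedRun.take1F_mem_FP
    (append_mem_FP
      (comp_mem_FP bitAtFn_mem_FP (fanoutFn_mem_FP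
        (comp_mem_FP binToUnaryFn_mem_FP (fanoutFn_mem_FP fstF_mem_FP (comp_mem_FP fstF_mem_FP sndF_mem_FP)))
        fstF_mem_FP))
      (const_mem_FP _))

/-- The "take one, default `0`" reading of a bit. [folklore] -/
theorem take_one_drop_append_false (u : List Bool) (v : ℕ) :
    ((u.drop (min v u.length)).take 1 ++ [false]).take 1 = [u.getD v false] := by
  by_cases hv : v < u.length
  · rw [Nat.min_eq_left hv.le, List.take_one_drop_eq_of_lt_length hv]
    simp [List.getD_eq_getElem?_getD, List.getElem?_eq_getElem hv]
  · rw [not_lt] at hv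
    rw [Nat.min_eq_right hv, List.drop_of_length_le le_rfl]
    simp [List.getD_eq_getElem?_getD, List.getElem?_eq_none hv]

/-- **Value of `bitOfF`.** [folklore] -/
theorem bitOfF_boolPair (u vnum pol : List Bool) :
    bitOfF (boolPair u (boolPair vnum pol)) = [u.getD (bitsToNat vnum) false] := by
  have hlen : (ones (min (bitsToNat vnum) u.length)).length = min (bitsToNat vnum) u.length := by
    simp [ones]
  rw [bitOfF, Function.comp_apply]
  simp only [Function.comp_apply, fanoutFn_apply, fstF_boolPair, sndF_boolPair,
    binToUnaryFn_boolPair, bitAtFn_boolPair, hlen]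
  rw [ClockedRun.take1F_apply, take_one_drop_append_false]

/-- **The literal test** on `⟨u, literal code⟩`: bit `v` of `u` equals the polarity. [folklore] -/
def litOkF : List Bool → List Bool :=
  eqPairFn ∘ fanoutFn bitOfF (sndF ∘ sndF)

/-- `litOkF ∈ FP`. [folklore] -/
theorem litOkF_mem_FP : litOkF ∈ FP :=
  comp_mem_FP eqPairFn_mem_FP (fanoutFn_mem_FP bitOfF_mem_FP (comp_mem_FP sndF_mem_FP sndF_mem_FP))

/-- `litOkF` is one-bit. [folklore] -/
theorem oneBit_litOkF : OneBit litOkF :=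
  oneBit_eqPairFn.comp _

/-- Value of `litOkF` on a literal code. [folklore] -/
theorem litOkF_boolPair_encode (u : List Bool) (l : Literal ℕ) :
    litOkF (boolPair u (encodingLiteral.encode l)) = [decide (u.getD l.1 false = l.2)] := by
  rw [litOkF, Function.comp_apply, fanoutFn_apply, encode_literal, bitOfF_boolPair, Function.comp_apply,
    sndF_boolPair, sndF_boolPair, bitsToNat_encodeNat, eqPairFn_boolPair]
  simp

/-- **The clause test** on `⟨u, clause code⟩`: some literal passes. [folklore] -/
def clauseOkF : List Bool → List Bool :=
  anyFn litOkF ∘ fanoutFn fstF (sndF ∘ sndF)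

/-- `clauseOkF ∈ FP`. [folklore] -/
theorem clauseOkF_mem_FP : clauseOkF ∈ FP :=
  comp_mem_FP (anyFn_mem_FP litOkF_mem_FP oneBit_litOkF)
    (fanoutFn_mem_FP fstF_mem_FP (comp_mem_FP sndF_mem_FP sndF_mem_FP))

/-- `clauseOkF` is one-bit. [folklore] -/
theorem oneBit_clauseOkF : OneBit clauseOkF :=
  (oneBit_anyFn oneBit_litOkF).comp _

/-- Value of `clauseOkF` on a clause code. [folklore] -/
theorem clauseOkF_boolPair_encode (u : List Bool) (c : Clause ℕ) :
    clauseOkF (boolPair u (encodingClause.encode c)) =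
      [decide (∃ l ∈ c, u.getD l.1 false = l.2)] := by
  rw [clauseOkF, Function.comp_apply, fanoutFn_apply, Function.comp_apply, fstF_boolPair, sndF_boolPair,
    sndF_encode_clause, anyFn_boolPair oneBit_litOkF, decNil_encList]
  congr 1
  rw [Bool.eq_iff_iff]
  simp only [decide_eq_true_eq]
  constructor
  · rintro ⟨a, ha, h⟩
    obtain ⟨l, hl, rfl⟩ := List.mem_map.1 ha
    rw [litOkF_boolPair_encode] at h
    exact ⟨l, hl, by simpa using h⟩
  · rintro ⟨l, hl, h⟩
    exact ⟨_, List.mem_map.2 ⟨l, hl, rfl⟩, by rw [litOkF_boolPair_encode]; simpa using h⟩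

/-- **The CNF test** on `⟨u, CNF code⟩`: every clause passes. [folklore] -/
def cnfOkF : List Bool → List Bool :=
  allFn clauseOkF ∘ fanoutFn fstF (sndF ∘ sndF)

/-- `cnfOkF ∈ FP`. [folklore] -/
theorem cnfOkF_mem_FP : cnfOkF ∈ FP :=
  comp_mem_FP (allFn_mem_FP clauseOkF_mem_FP oneBit_clauseOkF)
    (fanoutFn_mem_FP fstF_mem_FP (comp_mem_FP sndF_mem_FP sndF_mem_FP))

/-- **Value of `cnfOkF` on a CNF code**: the CNF is true under `i ↦ u[i]` (default `0`).
[cite: AroraBarak2009, Def. 2.9] -/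
theorem cnfOkF_boolPair_encode (u : List Bool) (φ : CNF ℕ) :
    cnfOkF (boolPair u (encodingCNF.encode φ)) = [φ.eval fun i => u.getD i false] := by
  rw [cnfOkF, Function.comp_apply, fanoutFn_apply, Function.comp_apply, fstF_boolPair, sndF_boolPair,
    sndF_encode_cnf, allFn_boolPair oneBit_clauseOkF, decNil_encList]
  congr 1
  rw [Bool.eq_iff_iff, CNF.eval_eq_true_iff]
  simp only [decide_eq_true_eq, List.forall_mem_map, clauseOkF_boolPair_encode, List.cons.injEq,
    and_true]
  refine forall₂_congr fun c _ => ?_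
  simp [Clause.eval, Literal.eval, List.any_eq_true]

/-- **The characteristic string function** of `SAT` on the numeral of `pairVal x y`: split the
pairing (`ClockedRun.lowF`/`highF`), name the CNF string `numStr x` (`ClockedRun.numStrF`),
canonicalise it (`KSATRed.canonCNFFn = encode ∘ decCNF`), read the bits of `y` (`norm`), test
(`cnfOkF`). [cite: AroraBarak2009, §1.3] -/
def satStrF : List Bool → List Bool :=
  cnfOkF ∘ fanoutFn (norm ∘ ClockedRun.highF) (KSATRed.canonCNFFn ∘ ClockedRun.numStrF ∘ ClockedRun.lowF)

/-- `satStrF ∈ FP`. [folklore] -/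
theorem satStrF_mem_FP : satStrF ∈ FP :=
  comp_mem_FP cnfOkF_mem_FP (fanoutFn_mem_FP (comp_mem_FP norm_mem_FP ClockedRun.highF_mem_FP)
    (comp_mem_FP KSATRed.canonCNFFn_mem_FP (comp_mem_FP ClockedRun.numStrF_mem_FP ClockedRun.lowF_mem_FP)))

/-- Bits of a canonical numeral are the binary digits (`Com.testBit_bitsToNat`). [folklore] -/
private theorem getD_encodeNat_eq_testBit (y i : ℕ) : (encodeNat y).getD i false = y.testBit i := by
  rw [← Com.testBit_bitsToNat, bitsToNat_encodeNat]

/-- **Value of `satStrF` on a pair**: `[SAT(x, y)]`. [folklore] -/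
theorem satStrF_encodeNat_pairVal (x y : ℕ) :
    satStrF (encodeNat (pairVal x y)) = [decide (BussSat x y)] := by
  rw [satStrF, Function.comp_apply, fanoutFn_apply, Function.comp_apply, Function.comp_apply,
    Function.comp_apply, ClockedRun.highF_encodeNat_pairVal, ClockedRun.norm_padTo_encodeNat,
    ClockedRun.lowF_encodeNat_pairVal, ClockedRun.numStrF_padTo_encodeNat, KSATRed.canonCNFFn_eq,
    cnfOkF_boolPair_encode]
  simp only [getD_encodeNat_eq_testBit, BussSat, cnfOfNum, Bool.decide_eq_true]
  rfl

end BussSatFn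

/-- **The characteristic function of `SAT`** as a function of one number:
`satChar (pairVal x y) = [SAT(x, y)]` (`satChar_pairVal`; junk, but well defined, off pairs).
[folklore] -/
def satChar (p : ℕ) : ℕ :=
  bitsToNat (BussSatFn.satStrF (encodeNat p))

/-- Value of `satChar` on a pair. [folklore] -/
theorem satChar_pairVal (x y : ℕ) : satChar (pairVal x y) = if BussSat x y then 1 else 0 := by
  rw [satChar, BussSatFn.satStrF_encodeNat_pairVal]
  by_cases h : BussSat x y <;> simp [h]

/-- **The characteristic function of `SAT` is polynomial time** on binary numerals
(`BussSatFn.satStrF_mem_FP`, output normalised by `norm`). [cite: AroraBarak2009, §1.3] -/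
theorem polyTime_satChar : PolyTimeComputable encodeNat encodeNat satChar :=
  -- `hout` is `id ((norm ∘ satStrF) (encodeNat p)) = encodeNat (satChar p)`: closed through `id_eq`
  -- and `norm_eq_encodeNat`, never by unfolding the bricks
  PolyTimeComputable.of_encode (F := norm ∘ BussSatFn.satStrF) (ea' := id) (eb' := id)
    (comp_mem_FP norm_mem_FP BussSatFn.satStrF_mem_FP) encodeNat (fun _ => rfl)
    fun _ => (id_eq _).trans ((Function.comp_apply).trans (norm_eq_encodeNat _))

/-! ## "`G(x̄) = 1`" in its two forms, for any uniform definition `G` -/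

namespace GDef

variable {n : ℕ}

/-- **`G(x̄) = 1`, `Σᵇ₁` form**: `∃ y ≤ t_G(x̄) (φ_G(x̄, y) ∧ y = 1)` (Buss 1986, §2.2, Thm. 2.2:
atomic formulas in `Σᵇ₁`-defined function symbols are `Δᵇ₁` in `S₂¹`). [cite: Buss1986, §2.2, Thm. 2.2] -/
def isOneSig (G : GDef n) : SForm n :=
  SForm.bex G.bound (SForm.and G.graph (SForm.eq (Term.var (Fin.last n)) (natConst 1)))

/-- **`G(x̄) = 1`, `Πᵇ₁` form**: `∀ y ≤ t_G(x̄) (φ_G(x̄, y) → y = 1)`. [cite: Buss1986, §2.2, Thm. 2.2] -/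
def isOnePi (G : GDef n) : SForm n :=
  SForm.ball G.bound (SForm.imp G.graph (SForm.eq (Term.var (Fin.last n)) (natConst 1)))

/-- The `Σᵇ₁` form is syntactically `Σᵇ₁` when the graph is. [cite: Buss1986, §2.1] -/
theorem isSig_isOneSig {G : GDef n} (h : G.graph.IsSig) : (isOneSig G).IsSig := by
  simp_all [SForm.IsSig, isOneSig, SForm.cls]

/-- The `Πᵇ₁` form is syntactically `Πᵇ₁` when the graph is `Σᵇ₁`. [cite: Buss1986, §2.1] -/
theorem isPi_isOnePi {G : GDef n} (h : G.graph.IsSig) : (isOnePi G).IsPi := by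
  simp_all [SForm.IsSig, SForm.IsPi, isOnePi, SForm.cls]

section Models

open BASICModel

variable {M : Type} [Language.boundedArith.Structure M] [hB : M ⊨ BASIC]

/-- Numerals do not depend on the variable context. [folklore] -/
theorem realize_natConst_snoc (k : ℕ) (v : Fin n → M) (a : M) :
    (natConst k : Language.boundedArith.Term (Fin (n + 1))).realize (Fin.snoc v a) =
      (natConst k : Language.boundedArith.Term (Fin n)).realize v := by
  rw [realize_natConst_cast, realize_natConst_cast]

variable {G : GDef n}

/-- **Semantics of the `Σᵇ₁` form**: in a structure in which `G` is total, functional and bounded by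
its term, `isOneSig G` holds of `x̄` iff `G.fn x̄` is (the value of the numeral) `1`.
[cite: Buss1986, §2.2, Thm. 2.2] -/
theorem realize_isOneSig (hG : G.IsFnIn M) (v : Fin n → M) :
    (isOneSig G).Realize v ↔ G.fn v = (natConst 1 : Language.boundedArith.Term (Fin n)).realize v := by
  simp only [isOneSig, SForm.realize_bex, SForm.realize_and, SForm.realize_eq, Term.realize_var,
    Fin.snoc_last, realize_natConst_snoc]
  constructor
  · rintro ⟨a, -, hrel, ha⟩
    rw [hG.fn_eq_of_rel hrel, ha]
  · intro h
    exact ⟨G.fn v, hG.fn_le v, hG.rel_fn v, h⟩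

/-- **Semantics of the `Πᵇ₁` form**: the same. [cite: Buss1986, §2.2, Thm. 2.2] -/
theorem realize_isOnePi (hG : G.IsFnIn M) (v : Fin n → M) :
    (isOnePi G).Realize v ↔ G.fn v = (natConst 1 : Language.boundedArith.Term (Fin n)).realize v := by
  simp only [isOnePi, SForm.realize_ball, SForm.realize_imp, SForm.realize_eq, Term.realize_var,
    Fin.snoc_last, realize_natConst_snoc]
  constructor
  · intro h
    exact h (G.fn v) (hG.fn_le v) (hG.rel_fn v)
  · intro h a _ hrel
    rw [← hG.fn_eq_of_rel hrel, h]

/-- **The two forms agree** wherever `G` is total and functional. [cite: Buss1986, §2.2, Thm. 2.2] -/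
theorem realize_isOneSig_iff_isOnePi (hG : G.IsFnIn M) (v : Fin n → M) :
    (isOneSig G).Realize v ↔ (isOnePi G).Realize v := by
  rw [realize_isOneSig hG, realize_isOnePi hG]

end Models

/-- **`S₂¹` proves the two forms equivalent** (semantically, Mathlib's `⊨ᵇ`): for a good `G`
(total and functional in every model of `BASIC + Σᵇ₁-PIND = S₂¹`), `isOneSig G ⇔ isOnePi G` holds in
every model of `S₂¹` under every assignment — "`G(x̄) = 1`" is `Δᵇ₁` with respect to `S₂¹`.
[cite: Buss1986, §2.2, Thm. 2.2] -/
theorem models_isOneSig_iff_isOnePi {G : GDef n} (hG : G.Good) :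
    S2 1 ⊨ᵇ ((isOneSig G).toFormula ⇔ (isOnePi G).toFormula) := by
  intro M v xs
  haveI : (M : Type) ⊨ BASIC := (Theory.model_union_iff.1 M.is_model).1
  haveI : (M : Type) ⊨ PINDScheme (sigmabFormulas 1) := (Theory.model_union_iff.1 M.is_model).2
  rw [BoundedFormula.realize_iff]
  have h1 := SForm.realize_toFormula (isOneSig G) v
  have h2 := SForm.realize_toFormula (isOnePi G) v
  rw [Formula.Realize] at h1 h2
  rw [Unique.eq_default xs, h1, h2]
  exact realize_isOneSig_iff_isOnePi (hG.isFn M) v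

end GDef

/-! ## The uniform definition of `SAT` and the formula -/

/-- **The uniform `Σᵇ₁` definition of the characteristic function of `SAT`** in the two variables
`(x, y)`: `GDef.ofPolyTime polyTime_satChar` at the pairing term `pairTm x₀ x₁`.
[cite: Buss1986, Ch. 3] -/
def satG : GDef 2 :=
  GDef.substArgs ![pairTm (Term.var 0) (Term.var 1)] (GDef.ofPolyTime polyTime_satChar)

/-- `satG` is good (graph `Σᵇ₁`, total and functional in every model of `S₂¹`). [cite: Buss1986, Ch. 3] -/
theorem good_satG : satG.Good :=
  (GDef.good_ofPolyTime _).substArgs _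

/-- **Value of `satG` in `ℕ`**: `[SAT(x, y)]`. [cite: Buss1986, Ch. 3] -/
theorem fn_satG (x y : ℕ) : satG.fn ![x, y] = if BussSat x y then 1 else 0 := by
  haveI : ℕ ⊨ BASIC := model_nat_BASIC_holds
  haveI : ℕ ⊨ PINDScheme (sigmabFormulas 1) := model_nat_PINDScheme _
  rw [satG, GDef.fn_substArgs (GDef.good_ofPolyTime _)]
  have h : (fun j : Fin 1 =>
      ((![pairTm (Term.var 0) (Term.var 1)] : Fin 1 → Language.boundedArith.Term (Fin 2)) j).realize ![x, y]) =
      ![pairVal x y] := by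
    funext j
    fin_cases j
    simp
  rw [h, GDef.fn_ofPolyTime, satChar_pairVal]

/-- **`SAT(x₀, x₁)` — Buss's bounded formula, `Σᵇ₁` form** (the definition requested as
`BussSatFormula`): `∃ y ≤ t(x₀, x₁) (φ_sat(x₀, x₁, y) ∧ y = 1)` with `φ_sat` the `Σᵇ₁` graph of the
uniform definition `satG` of the characteristic function of `SAT`. `Δᵇ₁` with respect to `S₂¹`
(`bussSatFormula_iff_pi`), and in `ℕ` it says: the CNF with G01 code `numStr x₀` is satisfied by
the assignment `i ↦ bit i of x₁` (`realize_bussSatFormula`). [cite: PichSanthanam2026, §3.2] -/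
def bussSatFormula : Language.boundedArith.Formula (Fin 2) :=
  (GDef.isOneSig satG).toFormula

/-- **`SAT(x₀, x₁)`, `Πᵇ₁` form**: `∀ y ≤ t(x₀, x₁) (φ_sat(x₀, x₁, y) → y = 1)`.
[cite: PichSanthanam2026, §3.2] -/
def bussSatFormulaPi : Language.boundedArith.Formula (Fin 2) :=
  (GDef.isOnePi satG).toFormula

/-- `bussSatFormula` is a `Σᵇ₁` formula. [cite: Buss1986, §2.1] -/
theorem isSigmab_bussSatFormula : IsSigmab 1 bussSatFormula :=
  SForm.isSigmab_toFormula (GDef.isSig_isOneSig good_satG.sig)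

/-- `bussSatFormulaPi` is a `Πᵇ₁` formula. [cite: Buss1986, §2.1] -/
theorem isPib_bussSatFormulaPi : IsPib 1 bussSatFormulaPi :=
  SForm.isPib_toFormula (GDef.isPi_isOnePi good_satG.sig)

/-- **`SAT` is `Δᵇ₁` with respect to `S₂¹`**: `S₂¹ ⊨ᵇ SAT_Σ(x₀, x₁) ⇔ SAT_Π(x₀, x₁)`.
[cite: Buss1986, §2.2, Thm. 2.2] -/
theorem bussSatFormula_iff_pi : S2 1 ⊨ᵇ (bussSatFormula ⇔ bussSatFormulaPi) :=
  GDef.models_isOneSig_iff_isOnePi good_satG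

/-- **Agreement in the standard model**: `ℕ ⊨ SAT(x, y) ↔ BussSat x y`.
[cite: PichSanthanam2026, §3.2] -/
theorem realize_bussSatFormula (x y : ℕ) : bussSatFormula.Realize ![x, y] ↔ BussSat x y := by
  haveI : ℕ ⊨ BASIC := model_nat_BASIC_holds
  haveI : ℕ ⊨ PINDScheme (sigmabFormulas 1) := model_nat_PINDScheme _
  rw [bussSatFormula, SForm.realize_toFormula, GDef.realize_isOneSig (good_satG.isFn ℕ), fn_satG,
    realize_natConst]
  by_cases h : BussSat x y <;> simp [h]

/-- The `Πᵇ₁` form agrees as well. [cite: PichSanthanam2026, §3.2] -/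
theorem realize_bussSatFormulaPi (x y : ℕ) : bussSatFormulaPi.Realize ![x, y] ↔ BussSat x y := by
  haveI : ℕ ⊨ BASIC := model_nat_BASIC_holds
  haveI : ℕ ⊨ PINDScheme (sigmabFormulas 1) := model_nat_PINDScheme _
  rw [bussSatFormulaPi, SForm.realize_toFormula, GDef.realize_isOnePi (good_satG.isFn ℕ), fn_satG,
    realize_natConst]
  by_cases h : BussSat x y <;> simp [h]

/-- **Agreement in the standard model, decoder form** (as requested):
`ℕ ⊨ SAT(x, y)` iff `encodingCNF` decodes `numStr x` to a CNF made true by `i ↦ bit i of y`.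
[cite: PichSanthanam2026, §3.2] -/
theorem realize_bussSatFormula_iff_decode (x y : ℕ) :
    bussSatFormula.Realize ![x, y] ↔
      ∃ φ : CNF ℕ, encodingCNF.decode (numStr x) = some φ ∧ φ.eval (fun i => y.testBit i) = true := by
  rw [realize_bussSatFormula, bussSat_iff_decode]

/-- On genuine codes: `ℕ ⊨ SAT(strNum (code φ), y)` iff `φ` is true under the bits of `y`.
[cite: PichSanthanam2026, §3.2] -/
theorem realize_bussSatFormula_strNum_encode (φ : CNF ℕ) (y : ℕ) :
    bussSatFormula.Realize ![strNum (encodingCNF.encode φ), y] ↔ φ.eval (fun i => y.testBit i) = true := by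
  rw [realize_bussSatFormula, bussSat_strNum_encode]; rfl

end Literature.Computability.MetaComplexity

end
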